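import Mathlib

/-!
# BlochSeedDiscOne — the dual-certificate family (lens `dual`, g4): the RESTRICTION CALCULUS of residual universes,
failed-literal (peel) soundness, and the LEXICOGRAPHIC PHASE LAW

Companion to `DualCertificateLaw.lean` (g0), `DualCertificateLawBand.lean` (g1), `DualCertificateLawFamily.lean` (g2),
`DualCertificateLawRealise.lean` (g3).  Evidence-grade kernel facts about the CLASS ⊗ STATIC instrument of record (the third-code
residual CNFs on which every census of the HSemireg ladder is computed); nothing in this file is a step toward `HC`, `HC_CM`, `HC_AV`,
crux №4 / 26512 / 18881 / H2 — seats produce evidence and typed files, not rungs.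

## Setting

A variable type `V` (the G₁-orbit columns, both levels).  A clause of the third-code body (families DN/DP: one negative literal = the
head; Xp/Am: three negative literals head/q/n; positive literals on one level) is a pair of finite sets `(neg, pos)`; a support
`Y : Finset V` — read as the 0/1 assignment «exactly `Y` true» — satisfies it when `neg ⊆ Y → (pos ∩ Y).Nonempty` (`Clause.Holds`);
`Static B Y` says `Y` satisfies every clause of the family `B`.  A (sub-)universe is a set of admissible variables `T : Finset V`
(the orbits whose four letters have causal tops in a given interval `[h − b, h]`).  The encoder of record builds the body of the
universe `T` as the RESTRICTION `restrictFam T B` of the full body: the clauses whose negative literals lie inside `T`, with the positive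
literals outside `T` deleted (subuni.py, quick fact (cxix): every closedness predicate depends on the support only; stage2.py;
residual_sub.py).  The residual instrument of `T` is the restriction to the peel survivors `T \ E`, the peel `E` being produced by
iterated failed-literal elimination.

## What is certified here (all `h`, all bands; no census enters the hypotheses)

* §1 RESTRICTION CALCULUS. `static_restrict_iff` : for `Y ⊆ T`, `Static (restrictFam T B) Y ↔ Static B Y` — a sub-universe body
  has exactly the models of the full body that live inside the sub-universe; `restrict_restrict` / `restrictFam_restrictFam` :
  restriction is functorial (`T ⊆ T'` ⇒ restricting to `T'` then to `T` = restricting to `T`) — the (h, band) family is ONE PRESHEAF on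
  tops-intervals; `static_mono_universe` : a support static in universe `T` is static IN PLACE in every `T' ⊇ T`; `witnessed_mono` :
  hence every support-level verdict «some static `Y ⊆ T` has property `P`» (census-SAT of a column, REALISED(φ), class-full, alive …) is
  MONOTONE in the universe — the in-place half of the UP-SET law (the shift half is boost blindness, tree
  `Summits.Ventures.HSemireg.Pad4TowerB1OddBoostBlind.cellRealisable_boost`).
* §2 PEEL SOUNDNESS. Unit propagation from «`v` true, `E` false» as an inductive derivation `UP B E v x b`; `UP.sound` : every derived
  literal holds in every model containing `v` and avoiding `E`; `failed_literal_sound` : a UP-conflict proves `v` lies in no such model;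
  `PeelSound` (every eliminated variable is false in every model inside `T`) is preserved by failed-literal steps
  (`peelSound_insert`) and implied by leaving the universe (`peelSound_compl`), so `static_residual_iff` : for a sound peel the residual
  `restrictFam (T \ E) B` has, inside `T`, exactly the models of `B` — the census is a property of the residual of record, and restricting a
  residual of record and re-peeling computes the residual of the sub-universe (`g4 restrict.py`; 12/12 byte-identical reproductions of
  residual CNFs of record, memo `DUAL-CERT-FAMILY-g4.md` §1).
* §3 THE PHASE LAW, abstract form. For a verdict `Alive : ℕ × ℕ → Prop` monotone in the componentwise order on cells `(h, band)`
  (`static_mono_universe` + boost blindness + band inclusion), two generator cells `θ = (h₀, b₀)` and `(h₀ + 2, 0)` force the whole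
  LEXICOGRAPHIC up-set `{h ≥ h₀ + 2} ∪ {h = h₀, b ≥ b₀}` (`alive_of_generators`); §4 the census TABLE of record + g4 (20 cells ×
  {Re, Im} × {±}) as data, with `decide`d checks: it is an up-set for the componentwise order and it EQUALS the lexicographic threshold law
  with `θ(±Im) = (12,4)`, `θ(+Re) = (14,2)`, `θ(−Re) = (14,4)` on all 80 entries (`table_upset`, `table_lex`).  The table entries are DATA
  (each an exact certificate re-checked by an independent script, memo §2–§3), not kernel facts about sheaves.
-/

set_option linter.dupNamespace false

namespace Summit.HodgeConjecture.HodgeConjecture.Cruxes.BlochSeedDiscOne.DualLawRestrict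

open Finset

variable {V : Type*} [DecidableEq V]

/-! ## §1 Clause systems, static supports, restriction to a sub-universe -/

/-- a clause of the third-code body: negative literals `neg`, positive literals `pos`. -/
structure Clause (V : Type*) where
  neg : Finset V
  pos : Finset V

/-- the 0/1 assignment «exactly `Y` true» satisfies the clause. -/
def Clause.Holds (c : Clause V) (Y : Finset V) : Prop := c.neg ⊆ Y → (c.pos ∩ Y).Nonempty

/-- `Y` is STATIC for the clause family `B`: it satisfies every clause. -/
def Static (B : Set (Clause V)) (Y : Finset V) : Prop := ∀ c ∈ B, c.Holds Y

/-- restriction of one clause to the sub-universe `T`: positive literals outside `T` are deleted (they are false for ever). -/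
def Clause.restrict (T : Finset V) (c : Clause V) : Clause V := ⟨c.neg, c.pos ∩ T⟩

/-- the body of the sub-universe `T`: the clauses whose negative literals all lie in `T` (the others can never fire), restricted. -/
def restrictFam (T : Finset V) (B : Set (Clause V)) : Set (Clause V) :=
  (Clause.restrict T) '' {c | c ∈ B ∧ c.neg ⊆ T}

@[simp] theorem restrict_neg (T : Finset V) (c : Clause V) : (c.restrict T).neg = c.neg := rfl
@[simp] theorem restrict_pos (T : Finset V) (c : Clause V) : (c.restrict T).pos = c.pos ∩ T := rfl

/-- inside the sub-universe a restricted clause holds iff the original clause holds. -/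
theorem holds_restrict_iff {T Y : Finset V} (hY : Y ⊆ T) (c : Clause V) :
    (c.restrict T).Holds Y ↔ c.Holds Y := by
  have h : c.pos ∩ T ∩ Y = c.pos ∩ Y := by
    ext x
    simp only [mem_inter]
    constructor
    · rintro ⟨⟨hp, -⟩, hy⟩; exact ⟨hp, hy⟩
    · rintro ⟨hp, hy⟩; exact ⟨⟨hp, hY hy⟩, hy⟩
  unfold Clause.Holds
  rw [restrict_neg, restrict_pos, h]

/-- a clause with a negative literal outside the sub-universe holds on every support inside it (it never fires). -/
theorem holds_of_not_neg_subset {T Y : Finset V} (hY : Y ⊆ T) {c : Clause V} (hc : ¬ c.neg ⊆ T) : c.Holds Y :=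
  fun h => absurd (h.trans hY) hc

/-- **RESTRICTION PRINCIPLE**: inside `T`, the sub-universe body `restrictFam T B` has exactly the models of the full body `B`. -/
theorem static_restrict_iff {T Y : Finset V} (hY : Y ⊆ T) (B : Set (Clause V)) :
    Static (restrictFam T B) Y ↔ Static B Y := by
  constructor
  · intro h c hc
    by_cases hn : c.neg ⊆ T
    · exact (holds_restrict_iff hY c).mp (h _ ⟨c, ⟨hc, hn⟩, rfl⟩)
    · exact holds_of_not_neg_subset hY hn
  · rintro h _ ⟨c, ⟨hc, -⟩, rfl⟩
    exact (holds_restrict_iff hY c).mpr (h c hc)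

/-- restriction of clauses is functorial. -/
theorem restrict_restrict {T T' : Finset V} (hT : T ⊆ T') (c : Clause V) :
    (c.restrict T').restrict T = c.restrict T := by
  show Clause.mk c.neg (c.pos ∩ T' ∩ T) = Clause.mk c.neg (c.pos ∩ T)
  rw [inter_assoc, inter_eq_right.mpr hT]

/-- **PRESHEAF LAW**: restricting the universe `T'` body to `T ⊆ T'` gives the universe `T` body. -/
theorem restrictFam_restrictFam {T T' : Finset V} (hT : T ⊆ T') (B : Set (Clause V)) :
    restrictFam T (restrictFam T' B) = restrictFam T B := by
  ext d
  constructor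
  · rintro ⟨c', ⟨⟨c, ⟨hc, -⟩, rfl⟩, hn⟩, rfl⟩
    exact ⟨c, ⟨hc, hn⟩, (restrict_restrict hT c).symm⟩
  · rintro ⟨c, ⟨hc, hn⟩, rfl⟩
    exact ⟨c.restrict T', ⟨⟨c, ⟨hc, hn.trans hT⟩, rfl⟩, hn⟩, restrict_restrict hT c⟩

/-- **IN-PLACE MONOTONICITY**: a support static in the universe `T` is static, in place, in every bigger universe `T' ⊇ T`. -/
theorem static_mono_universe {T T' Y : Finset V} (hT : T ⊆ T') (hY : Y ⊆ T) {B : Set (Clause V)}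
    (h : Static (restrictFam T B) Y) : Static (restrictFam T' B) Y :=
  (static_restrict_iff (hY.trans hT) B).mpr ((static_restrict_iff hY B).mp h)

/-- a support-level verdict of the universe `T`: some static support inside `T` has the (universe-independent) property `P`
(examples: `P Y := v ∈ Y` — census-SAT of the column `v`; `P Y := ∃ m, Realises R A φ Y m` — REALISED(φ); class-full; alive). -/
def Witnessed (B : Set (Clause V)) (T : Finset V) (P : Finset V → Prop) : Prop :=
  ∃ Y, Y ⊆ T ∧ Static (restrictFam T B) Y ∧ P Y

/-- every support-level verdict is MONOTONE in the universe: the in-place half of the UP-SET law. -/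
theorem witnessed_mono {B : Set (Clause V)} {T T' : Finset V} (hT : T ⊆ T') {P : Finset V → Prop}
    (h : Witnessed B T P) : Witnessed B T' P := by
  obtain ⟨Y, hY, hS, hP⟩ := h
  exact ⟨Y, hY.trans hT, static_mono_universe hT hY hS, hP⟩

/-- dually, a support-level DEATH («no static support inside `T'` has `P`») restricts to every sub-universe. -/
theorem dead_anti {B : Set (Clause V)} {T T' : Finset V} (hT : T ⊆ T') {P : Finset V → Prop}
    (h : ¬ Witnessed B T' P) : ¬ Witnessed B T P :=
  fun w => h (witnessed_mono hT w)

/-! ## §2 Failed-literal elimination (the peel) is sound -/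

/-- unit propagation from the assumptions «`v` true» and «every `e ∈ E` false»: `UP B E v x b` = the literal `x ↦ b` is derived.
Rules: the two assumption rules; a clause all of whose literals but one negative literal `x` are falsified derives `x ↦ false`;
a clause all of whose literals but one positive literal `x` are falsified derives `x ↦ true`. -/
inductive UP (B : Set (Clause V)) (E : Finset V) (v : V) : V → Bool → Prop
  | probe : UP B E v v true
  | elim {e : V} : e ∈ E → UP B E v e false
  | unit_neg {c : Clause V} {x : V} : c ∈ B → x ∈ c.neg →
      (∀ u ∈ c.neg, u ≠ x → UP B E v u true) → (∀ p ∈ c.pos, UP B E v p false) → UP B E v x false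
  | unit_pos {c : Clause V} {x : V} : c ∈ B → x ∈ c.pos →
      (∀ u ∈ c.neg, UP B E v u true) → (∀ p ∈ c.pos, p ≠ x → UP B E v p false) → UP B E v x true

/-- a UP-CONFLICT: some clause has all its literals falsified by derived literals. -/
def Conflict (B : Set (Clause V)) (E : Finset V) (v : V) : Prop :=
  ∃ c ∈ B, (∀ u ∈ c.neg, UP B E v u true) ∧ (∀ p ∈ c.pos, UP B E v p false)

/-- soundness of unit propagation: in a model containing `v` and avoiding `E`, every derived literal is true. -/
theorem UP.sound {B : Set (Clause V)} {E Y : Finset V} {v : V} (hS : Static B Y) (hv : v ∈ Y)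
    (hE : ∀ e ∈ E, e ∉ Y) {x : V} {b : Bool} (h : UP B E v x b) : (x ∈ Y ↔ b = true) := by
  induction h with
  | probe => simpa using hv
  | elim he => simpa using hE _ he
  | @unit_neg c x hc hx _ _ ihn ihp =>
    simp only [Bool.false_eq_true, iff_false]
    intro hxY
    have hsub : c.neg ⊆ Y := by
      intro u hu
      by_cases hux : u = x
      · exact hux ▸ hxY
      · exact (ihn u hu hux).mpr rfl
    obtain ⟨p, hp⟩ := hS c hc hsub
    rw [mem_inter] at hp
    exact absurd ((ihp p hp.1).mp hp.2) (by simp)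
  | @unit_pos c x hc hx _ _ ihn ihp =>
    simp only [iff_true]
    have hsub : c.neg ⊆ Y := fun u hu => (ihn u hu).mpr rfl
    obtain ⟨p, hp⟩ := hS c hc hsub
    rw [mem_inter] at hp
    by_cases hpx : p = x
    · exact hpx ▸ hp.2
    · exact absurd ((ihp p hp.1 hpx).mp hp.2) (by simp)

/-- **FAILED-LITERAL SOUNDNESS**: a UP-conflict from «`v` true, `E` false» proves that no model avoiding `E` contains `v`. -/
theorem failed_literal_sound {B : Set (Clause V)} {E Y : Finset V} {v : V} (hC : Conflict B E v)
    (hS : Static B Y) (hE : ∀ e ∈ E, e ∉ Y) : v ∉ Y := by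
  intro hv
  obtain ⟨c, hc, hn, hp⟩ := hC
  have hsub : c.neg ⊆ Y := fun u hu => (UP.sound hS hv hE (hn u hu)).mpr rfl
  obtain ⟨p, hq⟩ := hS c hc hsub
  rw [mem_inter] at hq
  exact absurd ((UP.sound hS hv hE (hp p hq.1)).mp hq.2) (by simp)

/-- the elimination set `E` is SOUND for the universe `T`: every eliminated variable is false in every model of `B` inside `T`. -/
def PeelSound (B : Set (Clause V)) (T E : Finset V) : Prop :=
  ∀ Y, Y ⊆ T → Static B Y → ∀ e ∈ E, e ∉ Y

/-- the empty peel is sound. -/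
theorem peelSound_empty (B : Set (Clause V)) (T : Finset V) : PeelSound B T ∅ := by
  intro Y _ _ e he; simp at he

/-- leaving the universe is sound: every variable outside `T` may be set false (the restriction step of `restrict.py`). -/
theorem peelSound_compl {B : Set (Clause V)} {T E : Finset V} (hE : Disjoint E T) : PeelSound B T E :=
  fun _ hY _ _ he heY => (disjoint_left.mp hE he) (hY heY)

/-- soundness is monotone under shrinking the universe. -/
theorem peelSound_mono_universe {B : Set (Clause V)} {T T' E : Finset V} (hT : T ⊆ T') (h : PeelSound B T' E) :
    PeelSound B T E :=
  fun Y hY hS => h Y (hY.trans hT) hS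

/-- the union of sound elimination sets is sound. -/
theorem peelSound_union {B : Set (Clause V)} {T E E' : Finset V} (h : PeelSound B T E) (h' : PeelSound B T E') :
    PeelSound B T (E ∪ E') := by
  intro Y hY hS e he
  rcases mem_union.mp he with he | he
  · exact h Y hY hS e he
  · exact h' Y hY hS e he

/-- **ONE PEEL STEP**: a failed literal `v` (UP-conflict from «`v` true, `E` false») may be added to a sound elimination set. -/
theorem peelSound_insert {B : Set (Clause V)} {T E : Finset V} {v : V} (h : PeelSound B T E) (hC : Conflict B E v) :
    PeelSound B T (insert v E) := by
  intro Y hY hS e he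
  rcases mem_insert.mp he with rfl | he
  · exact failed_literal_sound hC hS (h Y hY hS)
  · exact h Y hY hS e he

/-- a whole peel run (a list of failed literals, each failing under the eliminations made before it) is sound. -/
theorem peelSound_run {B : Set (Clause V)} {T : Finset V} :
    ∀ (run : List V) (E : Finset V), PeelSound B T E →
      (∀ k (hk : k < run.length), Conflict B (E ∪ (run.take k).toFinset) (run.get ⟨k, hk⟩)) →
      PeelSound B T (E ∪ run.toFinset)
  | [], E, h, _ => by simpa using h
  | v :: run, E, h, hc => by
    have h0 : Conflict B E v := by simpa using hc 0 (by simp)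
    have h1 : PeelSound B T (insert v E) := peelSound_insert h h0
    have key := peelSound_run run (insert v E) h1 (fun k hk => by
      have := hc (k + 1) (by simpa using hk)
      simpa [List.take_succ_cons, Finset.insert_union, Finset.union_insert] using this)
    simpa [Finset.union_insert, Finset.insert_union] using key

/-- **THE RESIDUAL HAS THE SAME MODELS**: for a sound peel `E` of the universe `T`, a support inside `T` is a model of the full body iff it
avoids `E` and is a model of the residual `restrictFam (T \ E) B` (the residual CNF of record). -/
theorem static_residual_iff {B : Set (Clause V)} {T E Y : Finset V} (hE : PeelSound B T E) (hY : Y ⊆ T) :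
    Static B Y ↔ Y ⊆ T \ E ∧ Static (restrictFam (T \ E) B) Y := by
  constructor
  · intro hS
    have hYE : Y ⊆ T \ E := fun x hx => mem_sdiff.mpr ⟨hY hx, fun hxE => hE Y hY hS x hxE hx⟩
    exact ⟨hYE, (static_restrict_iff hYE B).mpr hS⟩
  · rintro ⟨hYE, hS⟩
    exact (static_restrict_iff hYE B).mp hS

/-- hence the census of a column is a property of the residual: `v` lies in a model of `B` inside `T` iff it lies in a model of the
residual inside `T \ E`. -/
theorem census_residual_iff {B : Set (Clause V)} {T E : Finset V} (hE : PeelSound B T E) (v : V) :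
    Witnessed B T (fun Y => v ∈ Y) ↔ Witnessed B (T \ E) (fun Y => v ∈ Y) := by
  constructor
  · rintro ⟨Y, hY, hS, hv⟩
    have hS' := (static_restrict_iff hY B).mp hS
    obtain ⟨hYE, hR⟩ := (static_residual_iff hE hY).mp hS'
    exact ⟨Y, hYE, hR, hv⟩
  · rintro ⟨Y, hY, hS, hv⟩
    exact ⟨Y, hY.trans sdiff_subset, static_mono_universe sdiff_subset hY hS, hv⟩

/-- **RESTRICT-THEN-REPEEL** (what `restrict.py` does): the residual of record of `T'` restricted to `T ⊆ T'` and re-peeled by a sound run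
`E` is the residual of `T` — it has, inside `T`, exactly the models of the full body. -/
theorem static_restrict_residual_iff {B : Set (Clause V)} {T T' E' E Y : Finset V} (hT : T ⊆ T')
    (hE' : PeelSound B T' E') (hE : PeelSound B T E) (hY : Y ⊆ T) :
    Static B Y ↔ Y ⊆ (T \ E') \ E ∧ Static (restrictFam ((T \ E') \ E) (restrictFam (T' \ E') B)) Y := by
  have hsub : (T \ E') \ E ⊆ T' \ E' := fun x hx => by
    simp only [mem_sdiff] at hx ⊢; exact ⟨hT hx.1.1, hx.1.2⟩
  rw [restrictFam_restrictFam hsub]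
  constructor
  · intro hS
    have h1 : Y ⊆ (T \ E') \ E := fun x hx => by
      simp only [mem_sdiff]
      exact ⟨⟨hY hx, fun hx' => hE' Y (hY.trans hT) hS x hx' hx⟩, fun hxE => hE Y hY hS x hxE hx⟩
    exact ⟨h1, (static_restrict_iff h1 B).mpr hS⟩
  · rintro ⟨h1, hS⟩
    exact (static_restrict_iff h1 B).mp hS

/-! ### §2b The bridge to the script's procedure (critic Q1, idea-crit-hsem-3 memo-46, 2026-08-29; added by plan-lens-HodgeAV-dual g5)

`restrict.py` executes the re-peel run on the RESTRICTED residual body — the CNF `restrictFam (T \ E') (restrictFam (T' \ E') B)` over the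
universe `T \ E'` — so `peelSound_run` certifies `PeelSound` for THAT family and THAT universe, while `static_restrict_residual_iff` asks for
`PeelSound B T E`.  The three lemmas below close the gap, so the kernel's hypotheses match the script literally
(`static_restrict_residual_iff_run`). -/

/-- peel-soundness is invariant under restricting the body to any super-universe `S ⊇ T` (models inside `T` are the same). -/
theorem peelSound_restrictFam_iff {B : Set (Clause V)} {S T E : Finset V} (hT : T ⊆ S) :
    PeelSound (restrictFam S B) T E ↔ PeelSound B T E :=
  ⟨fun h Y hY hS => h Y hY ((static_restrict_iff (hY.trans hT) B).mpr hS),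
   fun h Y hY hS => h Y hY ((static_restrict_iff (hY.trans hT) B).mp hS)⟩

/-- a peel that is sound over the smaller universe `T \ E'` is sound over `T`, provided `E'` is itself a sound peel of some `T' ⊇ T`
(every model inside `T` already avoids `E'`). -/
theorem peelSound_of_sdiff {B : Set (Clause V)} {T T' E' E : Finset V} (hT : T ⊆ T') (hE' : PeelSound B T' E')
    (h : PeelSound B (T \ E') E) : PeelSound B T E :=
  fun Y hY hS e he heY =>
    h Y (fun x hx => mem_sdiff.mpr ⟨hY hx, fun hx' => hE' Y (hY.trans hT) hS x hx' hx⟩) hS e he heY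

/-- **RESTRICT.PY, LITERALLY**: soundness of the re-peel run `E` established on the restricted residual body over `T \ E'` (which is what
`peelSound_run` yields for the script's run) is soundness for the full body `B` over `T`. -/
theorem peelSound_of_restricted_residual {B : Set (Clause V)} {T T' E' E : Finset V} (hT : T ⊆ T')
    (hE' : PeelSound B T' E') (h : PeelSound (restrictFam (T \ E') (restrictFam (T' \ E') B)) (T \ E') E) :
    PeelSound B T E := by
  have hsub : T \ E' ⊆ T' \ E' := fun x hx => by
    simp only [mem_sdiff] at hx ⊢; exact ⟨hT hx.1, hx.2⟩
  rw [restrictFam_restrictFam hsub, peelSound_restrictFam_iff subset_rfl] at h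
  exact peelSound_of_sdiff hT hE' h

/-- `static_restrict_residual_iff` with the run hypothesis stated on the restricted residual body, exactly as the script produces it. -/
theorem static_restrict_residual_iff_run {B : Set (Clause V)} {T T' E' E Y : Finset V} (hT : T ⊆ T')
    (hE' : PeelSound B T' E') (hrun : PeelSound (restrictFam (T \ E') (restrictFam (T' \ E') B)) (T \ E') E) (hY : Y ⊆ T) :
    Static B Y ↔ Y ⊆ (T \ E') \ E ∧ Static (restrictFam ((T \ E') \ E) (restrictFam (T' \ E') B)) Y :=
  static_restrict_residual_iff hT hE' (peelSound_of_restricted_residual hT hE' hrun) hY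

/-! ## §3 The phase law, abstract form: two generators + monotonicity ⇒ a lexicographic up-set -/

/-- the componentwise order on cells `(h, band)` (the UP-SET law: band inclusion, in-place inclusion §1, top shift by boost blindness). -/
abbrev CellLE (c d : ℕ × ℕ) : Prop := c.1 ≤ d.1 ∧ c.2 ≤ d.2

/-- the lexicographic up-set generated by the threshold `θ = (h₀, b₀)`, in steps of two rungs: `h ≥ h₀ + 2`, or `h = h₀` and `b ≥ b₀`. -/
abbrev LexUp (θ c : ℕ × ℕ) : Prop := θ.1 + 2 ≤ c.1 ∨ (c.1 = θ.1 ∧ θ.2 ≤ c.2)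

/-- **GENERATORS ⇒ LAW**: a monotone verdict alive at `θ = (h₀, b₀)` and at `(h₀ + 2, 0)` is alive on the whole lexicographic up-set of `θ`. -/
theorem alive_of_generators {Alive : ℕ × ℕ → Prop} (hmono : ∀ c d, CellLE c d → Alive c → Alive d)
    {θ : ℕ × ℕ} (h₁ : Alive θ) (h₂ : Alive (θ.1 + 2, 0)) (c : ℕ × ℕ) (hc : LexUp θ c) : Alive c := by
  rcases hc with hc | ⟨hc1, hc2⟩
  · exact hmono _ _ ⟨hc, Nat.zero_le _⟩ h₂
  · exact hmono _ _ ⟨by simp [hc1], hc2⟩ h₁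

/-- **DEAD CELLS BOUND THE LAW FROM BELOW**: a monotone verdict dead at `d` is dead at every `c ≤ d`. -/
theorem dead_of_le {Alive : ℕ × ℕ → Prop} (hmono : ∀ c d, CellLE c d → Alive c → Alive d)
    {c d : ℕ × ℕ} (hcd : CellLE c d) (hd : ¬ Alive d) : ¬ Alive c :=
  fun hc => hd (hmono _ _ hcd hc)

/-! ## §4 The census table of record + g4 (DATA) and its two `decide`d consistency checks -/

/-- the 20 censused cells `(h, band)` = tops-intervals `[h − b, h]`: h ≤ 10 and (14,2) by restriction (g4), the rest of record (g56 ∕ band-1 ∕ g3). -/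
def cells : List (ℕ × ℕ) :=
  [(4,0), (6,0), (6,2), (8,0), (8,2), (8,4), (10,0), (10,2), (10,4), (10,6),
   (12,0), (12,2), (12,4), (12,6), (12,8), (14,0), (14,2), (14,4), (14,6), (16,0)]

/-- REALISED(+Re): (14,2) `0b9542ae` (g4), (14,4), (14,6), (16,0). -/
def reP : List (ℕ × ℕ) := [(14,2), (14,4), (14,6), (16,0)]
/-- REALISED(−Re): (14,4), (14,6), (16,0); (14,2) is DEAD-CONE (g4), (14,0) DEAD-CONE. -/
def reM : List (ℕ × ℕ) := [(14,4), (14,6), (16,0)]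
/-- REALISED(±Im): (12,4), (12,6), (12,8), (14,0), (14,2), (14,4), (14,6), (16,0). -/
def imPM : List (ℕ × ℕ) := [(12,4), (12,6), (12,8), (14,0), (14,2), (14,4), (14,6), (16,0)]

/-- the four alive-tables are UP-SETS for the componentwise order on the censused cells (no realised cell lies below a dead one). -/
theorem table_upset :
    (∀ c ∈ cells, ∀ d ∈ cells, CellLE c d → c ∈ reP → d ∈ reP) ∧
    (∀ c ∈ cells, ∀ d ∈ cells, CellLE c d → c ∈ reM → d ∈ reM) ∧
    (∀ c ∈ cells, ∀ d ∈ cells, CellLE c d → c ∈ imPM → d ∈ imPM) := by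
  refine ⟨?_, ?_, ?_⟩ <;> decide

/-- **THE LEXICOGRAPHIC THRESHOLD LAW** on all 80 entries: `+Re` alive ⟺ `(h,b) ≥_lex (14,2)`, `−Re` ⟺ `≥_lex (14,4)`, `±Im` ⟺ `≥_lex (12,4)`. -/
theorem table_lex :
    (∀ c ∈ cells, c ∈ reP ↔ LexUp (14,2) c) ∧
    (∀ c ∈ cells, c ∈ reM ↔ LexUp (14,4) c) ∧
    (∀ c ∈ cells, c ∈ imPM ↔ LexUp (12,4) c) := by
  refine ⟨?_, ?_, ?_⟩ <;> decide

/-- the generators (minimal alive cells) of the three up-sets: `{(14,2),(16,0)}`, `{(14,4),(16,0)}`, `{(12,4),(14,0)}`. -/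
theorem table_generators :
    (∀ c ∈ cells, c ∈ reP ↔ (CellLE (14,2) c ∨ CellLE (16,0) c)) ∧
    (∀ c ∈ cells, c ∈ reM ↔ (CellLE (14,4) c ∨ CellLE (16,0) c)) ∧
    (∀ c ∈ cells, c ∈ imPM ↔ (CellLE (12,4) c ∨ CellLE (14,0) c)) := by
  refine ⟨?_, ?_, ?_⟩ <;> decide

end Summit.HodgeConjecture.HodgeConjecture.Cruxes.BlochSeedDiscOne.DualLawRestrict
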